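import Summits.BirchSwinnertonDyer.BirchSwinnertonDyer.Theorems.ByReductionTypeAtTwoFineSelmerConjAAtTwoAdditivePotGoodUniquePrimeDoor
import HarnessLib

/-!
# Route `ByReductionTypeAtTwo` (rung K4), crux C1″ `FineSelmerConjAAtTwoAdditivePotGood` (item stmt-BirchSwinnertonDyer-22615):
# THE INERT DOOR — «`r` odd and `p + q` odd ⟹ `2` is INERT in `ℚ(β)`» (KERNEL), so on the parity block the unique-prime door
# displays ONE bit: the parity of `h(ℚ(β))`
# (a `--supports 22615` file; seat `bsd-2adic-k4-w1` GEN 4; sequel of `…UniquePrimeDoor`; pen RC-341 (b)/(c): «decidable data: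
# factorisation of 2 in F_W and h(F_W)» — the first datum is now decided by the kernel from `(p, q, r) mod 2`)

HONEST FRAMING (cell `bsd-2adic`, D-0036/D-0054): types-the-object-of; closes nothing at the `∀`-level; nothing booked; BSD is
not proved by any of this. §1–§3 are UNCONDITIONAL kernel arithmetic; §4 is conditional on `hLim2` (Lim 2017 Thm. 3.5 at `2`)
BY NAME and on ONE displayed parity bit `2 ∤ #Cl(𝓞 ℚ(β))` (a class number, PRINT/LMFDB per field — not kernel).

THE ARGUMENT (elementary, no Kummer–Dedekind, no index computation). Let `K` be a number field and `b ∈ 𝓞 K` with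
`b³ + p b² + q b + r = 0`, `p, q, r ∈ ℤ`, `r` odd, `p + q` odd — i.e. the cubic reduces mod `2` to `X³ + X + 1` or `X³ + X² + 1`.
For every prime `v` of `𝓞 K` above `2` the residue field `k = 𝓞 K / v` has characteristic `2` and contains `x = b̄` with
`x³ + x + 1 = 0` or `x³ + x² + 1 = 0`; such an `x` has `x⁴ ≠ x` (§1), so `k ⊄ 𝔽₄`, hence `#k = N(v) ≥ 8` (`#k` is a power of `2`).
If `v ≠ w` are two primes above `2` then `v·w ⊇ (2)` (comaximal), so `N(v)·N(w) ∣ N((2)) = 2^{[K:ℚ]}`; for `[K : ℚ] = 3` this is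
`64 ≤ 8` — absurd. Hence EXACTLY ONE prime above `2` (indeed of residue degree `3`: `2` is inert).

* §1 `pow_four_ne_self_of_cubic_mod_two`, `eight_le_card_of_cubic_mod_two`, `cubic_mod_two_of_odd` (residue-field algebra).
* §2 `eight_le_absNorm_of_cubic_root` (any number field), **`existsUnique_two_mem_of_cubic_root`** (degree `3`): THE INERT CRITERION.
* §3 cubic currency: `exists_ringOfIntegers_cubic_root`, `finrank_adjoin_eq_three_of_odd`, **`existsUnique_two_mem_adjoin_of_odd`**
  (`r` odd ∧ `p + q` odd ⟹ exactly one prime of `ℚ(β)` above `2`), and **`classicalMuVanishes_two_adjoin_of_odd`: `r` odd,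
  `p + q` odd, `2 ∤ #Cl(𝓞 ℚ(β))` ⟹ `μ₂ = 0` (growth form, indeed `e_n = 0`) along EVERY `ℤ₂`-extension of `ℚ(β)` —
  UNCONDITIONAL** (Iwasawa 1956, kernel). This is the converse companion of `…CurveFreeHeart` §7 (there: C1″ ⟹ `μ₂(ℚ(β)) = 0`
  on the parity block; here: `μ₂(ℚ(β)) = 0` outright as soon as `h(ℚ(β))` is odd).
* §4 per curve (mod `hLim2`): `fineSelmerDual_moduleFinite_two_of_odd_cubic_pointField` — any elliptic `W/ℚ`, any `P ≠ 0` in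
  `W[2]` with `ℚ(P) = ℚ(β)` for such a `β`, odd `h(ℚ(β))` ⟹ (A)₂(W); and the cubic-model instance
  `fineSelmerDual_moduleFinite_two_cubicModel_of_odd` for `y² = x³ + px² + qx + r` itself.
* §5 the smallest cubic field `ℚ(θ)`, `θ³ = θ + 1` (disc `−23`, `h = 1` in print): `μ₂ = 0` for EVERY `ℤ₂`-extension of `ℚ(θ)`
  modulo the single displayed bit `2 ∤ #Cl(𝓞 ℚ(θ))` — `…CurveFreeHeart`'s refutation example is thereby decided on the
  `μ₂ = 0` side (audit-2 N7), kernel except for that bit.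

References: [Greenberg2001IwasawaPastPresent] Prop. 2.1 p. 339; [Washington1997] Prop. 13.22; [Lim2017FineSelmer] Thm. 3.5, Lemma 3.2;
[CoatesSujatha2005] (A); [Neukirch1999] I.§8 (fundamental identity; here replaced by a norm count); [Cohen1993] Table B.4 (h(−23) = 1).
-/

set_option autoImplicit false
-- sibling precedent (`…UniquePrimeDoor.lean`): the directory name repeats the summit name
set_option linter.dupNamespace false

noncomputable section

open scoped Classical IntermediateField NumberField

namespace Summit.BirchSwinnertonDyer.BirchSwinnertonDyer.Theorems.AddKatoTwo

open WeierstrassCurve Field Polynomial IsDedekindDomain Literature.NumberTheory.EllipticCurves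
  Literature.NumberTheory.GaloisRepresentations
  Literature.NumberTheory.IwasawaTheory
  Summit.BirchSwinnertonDyer.BirchSwinnertonDyer.Theorems.AlignedTransportAtTwoTorsionPointField
  Summit.BirchSwinnertonDyer.BirchSwinnertonDyer.Theses.ByReductionTypeAtTwo

/-! ## §1 Residue-field algebra in characteristic `2` -/

section ResidueField

/-- In a field with `2 = 0`, a root `x` of `X³ + X + 1` or of `X³ + X² + 1` has `x⁴ ≠ x` (so it does not lie in `𝔽₄`):
`x⁴ = x` would force `x² = 0` resp. `(x − 1)² = 0`, and neither `0` nor `1` is a root. [folklore] -/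
theorem pow_four_ne_self_of_cubic_mod_two {k : Type*} [Field k] (h2 : (2 : k) = 0) {x : k}
    (hx : x ^ 3 + x + 1 = 0 ∨ x ^ 3 + x ^ 2 + 1 = 0) : x ^ 4 ≠ x := by
  intro h4
  rcases hx with hx | hx
  · have hx2 : x ^ 2 = 0 := by linear_combination (-1 : k) * h4 + x * hx - x * h2
    have hx0 : x = 0 := pow_eq_zero_iff (n := 2) (by norm_num) |>.mp hx2
    rw [hx0] at hx; norm_num at hx
  · have hx2 : (x - 1) ^ 2 = 0 := by linear_combination h4 - (x - 1) * hx
    have hx1 : x = 1 := by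
      have := pow_eq_zero_iff (n := 2) (by norm_num) |>.mp hx2
      linear_combination this
    rw [hx1] at hx
    have h1 : (1 : k) = 0 := by linear_combination hx - h2
    exact one_ne_zero h1

/-- **A finite field of characteristic `2` containing a root of `X³ + X + 1` or `X³ + X² + 1` has at least `8` elements**
(its order `2ⁿ` has `n ≥ 3`, since every element of `𝔽₂`, `𝔽₄` satisfies `x⁴ = x`). [folklore] -/
theorem eight_le_card_of_cubic_mod_two {k : Type*} [Field k] [Finite k] (h2 : (2 : k) = 0) {x : k}
    (hx : x ^ 3 + x + 1 = 0 ∨ x ^ 3 + x ^ 2 + 1 = 0) : 8 ≤ Nat.card k := by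
  haveI := Fintype.ofFinite k
  haveI : CharP k 2 := (CharP.charP_iff_prime_eq_zero Nat.prime_two).mpr (by exact_mod_cast h2)
  obtain ⟨n, -, hcard⟩ := FiniteField.card k 2
  rw [Nat.card_eq_fintype_card, hcard]
  have hpow : x ^ (2 ^ (n : ℕ)) = x := by rw [← hcard]; exact FiniteField.pow_card x
  have hne := pow_four_ne_self_of_cubic_mod_two h2 hx
  by_contra hlt
  push Not at hlt
  have hn : (n : ℕ) ≤ 2 := by
    by_contra hn; push Not at hn
    have : 2 ^ 3 ≤ 2 ^ (n : ℕ) := Nat.pow_le_pow_right (by norm_num) hn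
    omega
  have hn1 := n.pos
  interval_cases hm : (n : ℕ)
  · rw [pow_one] at hpow
    exact hne (by rw [show x ^ 4 = (x ^ 2) ^ 2 by ring, hpow, hpow])
  · exact hne (by simpa using hpow)

/-- **Parity reduction**: in a ring with `2 = 0`, the relation `x³ + p x² + q x + r = 0` with `r` odd and `p + q` odd reads
`x³ + x + 1 = 0` (`p` even) or `x³ + x² + 1 = 0` (`p` odd). [folklore] -/
theorem cubic_mod_two_of_odd {k : Type*} [CommRing k] (h2 : (2 : k) = 0) {x : k} {p q r : ℤ} (hr : Odd r)
    (hpq : Odd (p + q)) (hx : x ^ 3 + (p : k) * x ^ 2 + (q : k) * x + (r : k) = 0) :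
    x ^ 3 + x + 1 = 0 ∨ x ^ 3 + x ^ 2 + 1 = 0 := by
  have hcast : ∀ z : ℤ, (z : k) = if Even z then 0 else 1 := by
    intro z
    split_ifs with hz
    · obtain ⟨m, rfl⟩ := hz; push_cast; linear_combination (m : k) * h2
    · rw [Int.not_even_iff_odd] at hz; obtain ⟨m, rfl⟩ := hz; push_cast; linear_combination (m : k) * h2
  have hrk : (r : k) = 1 := by rw [hcast, if_neg (Int.not_even_iff_odd.mpr hr)]
  rcases Int.even_or_odd p with hp | hp
  · have hq : Odd q := by
      rcases Int.even_or_odd q with hq | hq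
      · exact absurd (hp.add hq) (Int.not_even_iff_odd.mpr hpq)
      · exact hq
    left
    rw [hcast p, if_pos hp, hcast q, if_neg (Int.not_even_iff_odd.mpr hq), hrk] at hx
    linear_combination hx
  · have hq : Even q := by
      rcases Int.even_or_odd q with hq | hq
      · exact hq
      · exact absurd (hp.add_odd hq) (Int.not_even_iff_odd.mpr hpq)
    right
    rw [hcast p, if_neg (Int.not_even_iff_odd.mpr hp), hcast q, if_pos hq, hrk] at hx
    linear_combination hx

end ResidueField

/-! ## §2 THE INERT CRITERION for a number field -/

section InertCriterion

variable (K : Type) [Field K] [NumberField K]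

/-- **Every prime above `2` has norm `≥ 8`** once `𝓞 K` contains a root `b` of `X³ + pX² + qX + r` with `r` odd and `p + q` odd
(any degree): the residue field contains `b̄ ∉ 𝔽₄` (§1). [folklore] -/
theorem eight_le_absNorm_of_cubic_root (v : HeightOneSpectrum (𝓞 K)) (h2 : ((2 : ℕ) : 𝓞 K) ∈ v.asIdeal)
    (b : 𝓞 K) {p q r : ℤ} (hr : Odd r) (hpq : Odd (p + q))
    (hb : b ^ 3 + p * b ^ 2 + q * b + r = 0) : 8 ≤ Ideal.absNorm v.asIdeal := by
  haveI := v.isMaximal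
  letI := Ideal.Quotient.field v.asIdeal
  haveI : Finite (𝓞 K ⧸ v.asIdeal) := Ideal.finiteQuotientOfFreeOfNeBot v.asIdeal v.ne_bot
  rw [Ideal.absNorm_apply, Submodule.cardQuot_apply]
  have h2k : (2 : 𝓞 K ⧸ v.asIdeal) = 0 := by
    have := Ideal.Quotient.eq_zero_iff_mem.mpr h2
    rwa [Nat.cast_ofNat, map_ofNat] at this
  have hxeq : (Ideal.Quotient.mk v.asIdeal b) ^ 3 + (p : 𝓞 K ⧸ v.asIdeal) * (Ideal.Quotient.mk v.asIdeal b) ^ 2 +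
      (q : 𝓞 K ⧸ v.asIdeal) * (Ideal.Quotient.mk v.asIdeal b) + (r : 𝓞 K ⧸ v.asIdeal) = 0 := by
    have := congrArg (Ideal.Quotient.mk v.asIdeal) hb
    simpa using this
  exact eight_le_card_of_cubic_mod_two h2k (cubic_mod_two_of_odd h2k hr hpq hxeq)

/-- **THE INERT CRITERION (kernel).** A CUBIC number field `K` whose ring of integers contains a root `b` of
`X³ + pX² + qX + r` (`p q r : ℤ`, `r` ODD, `p + q` ODD — the cubic is `X³ + X + 1` or `X³ + X² + 1` mod `2`) has EXACTLY ONE prime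
above `2`: two distinct primes `v ≠ w` above `2` are comaximal, so `N(v)·N(w) ∣ N((2)) = 2³`, contradicting `N(v), N(w) ≥ 8` (§1–§2).
(In fact `2` is inert: the prime has residue degree `3`.) No Kummer–Dedekind, no index hypothesis. [folklore] -/
theorem existsUnique_two_mem_of_cubic_root (h3 : Module.finrank ℚ K = 3)
    (b : 𝓞 K) {p q r : ℤ} (hr : Odd r) (hpq : Odd (p + q)) (hb : b ^ 3 + p * b ^ 2 + q * b + r = 0) :
    ∃! v : HeightOneSpectrum (𝓞 K), ((2 : ℕ) : 𝓞 K) ∈ v.asIdeal := by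
  obtain ⟨v, hv⟩ := exists_heightOneSpectrum_two_mem K
  refine ⟨v, hv, fun w hw ↦ ?_⟩
  by_contra hne
  have h8v := eight_le_absNorm_of_cubic_root K v hv b hr hpq hb
  have h8w := eight_le_absNorm_of_cubic_root K w hw b hr hpq hb
  have hcop : w.asIdeal ⊔ v.asIdeal = ⊤ :=
    w.isMaximal.coprime_of_ne v.isMaximal (fun h ↦ hne (HeightOneSpectrum.ext h))
  have hle : Ideal.span {((2 : ℕ) : 𝓞 K)} ≤ w.asIdeal * v.asIdeal := by
    rw [Ideal.mul_eq_inf_of_coprime hcop, Ideal.span_singleton_le_iff_mem]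
    exact ⟨hw, hv⟩
  have hdvd := Ideal.absNorm_dvd_absNorm_of_le hle
  rw [map_mul, Ideal.absNorm_span_singleton] at hdvd
  have hnorm : Algebra.norm ℤ ((2 : ℕ) : 𝓞 K) = 2 ^ 3 := by
    have h2 : ((2 : ℕ) : 𝓞 K) = algebraMap ℤ (𝓞 K) 2 := by simp
    rw [h2, Algebra.norm_algebraMap, NumberField.RingOfIntegers.rank, h3]
  rw [hnorm] at hdvd
  have h8 := Nat.le_of_dvd (by norm_num) hdvd
  norm_num at h8
  have h64 := Nat.mul_le_mul h8w h8v
  linarith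

end InertCriterion

/-! ## §3 The cubic currency `ℚ(β)`: `r` odd ∧ `p + q` odd ⟹ one prime above `2` ⟹ (`h` odd) `μ₂ = 0` -/

section CubicCurrency

variable {p q r : ℤ}

/-- A root `β ∈ ℚ̄` of the monic integer cubic `X³ + pX² + qX + r` is an algebraic integer of `ℚ(β)` satisfying the
cubic in `𝓞 ℚ(β)`. [folklore] -/
theorem exists_ringOfIntegers_cubic_root {β : AlgebraicClosure ℚ} (hβ : aeval β (Cubic.toPoly ⟨1, (p : ℚ), q, r⟩) = 0) :
    ∃ b : 𝓞 (IntermediateField.adjoin ℚ {β}),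
      ((b : IntermediateField.adjoin ℚ {β}) : AlgebraicClosure ℚ) = β ∧ b ^ 3 + p * b ^ 2 + q * b + r = 0 := by
  have hmem : β ∈ IntermediateField.adjoin ℚ {β} := IntermediateField.mem_adjoin_simple_self ℚ β
  have hβQ : β ^ 3 + (p : AlgebraicClosure ℚ) * β ^ 2 + (q : AlgebraicClosure ℚ) * β + (r : AlgebraicClosure ℚ) = 0 := by
    have := hβ
    simp only [Cubic.toPoly, map_one, one_mul, aeval_add, aeval_mul, aeval_C, aeval_X_pow, aeval_X,
      eq_ratCast, Rat.cast_intCast] at this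
    exact this
  have hK : (⟨β, hmem⟩ : IntermediateField.adjoin ℚ {β}) ^ 3 + (p : IntermediateField.adjoin ℚ {β}) * ⟨β, hmem⟩ ^ 2 +
      (q : IntermediateField.adjoin ℚ {β}) * ⟨β, hmem⟩ + (r : IntermediateField.adjoin ℚ {β}) = 0 := by
    apply Subtype.ext
    push_cast
    exact hβQ
  refine ⟨⟨⟨β, hmem⟩, ⟨Cubic.toPoly ⟨1, p, q, r⟩, Cubic.monic_of_a_eq_one', ?_⟩⟩, rfl, ?_⟩
  · rw [← aeval_def]
    simp only [Cubic.toPoly, map_one, one_mul, aeval_add, aeval_mul, aeval_C, aeval_X_pow, aeval_X]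
    simp only [eq_intCast]
    exact hK
  · apply NumberField.RingOfIntegers.coe_injective
    push_cast
    simp only [NumberField.RingOfIntegers.map_mk]
    exact hK

/-- `[ℚ(β) : ℚ] = 3` for a root `β` of `X³ + pX² + qX + r` with `r` odd and `p + q` odd (irreducible: no root mod `2`). [folklore] -/
theorem finrank_adjoin_eq_three_of_odd (hr : Odd r) (hpq : Odd (p + q)) {β : AlgebraicClosure ℚ}
    (hβ : aeval β (Cubic.toPoly ⟨1, (p : ℚ), q, r⟩) = 0) :
    Module.finrank ℚ (IntermediateField.adjoin ℚ {β}) = 3 := by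
  have hfm : (Cubic.toPoly ⟨1, (p : ℚ), q, r⟩).Monic := Cubic.monic_of_a_eq_one'
  have hβint : IsIntegral ℚ β := ⟨_, hfm, by rwa [← aeval_def]⟩
  rw [IntermediateField.adjoin.finrank hβint, ← minpoly.eq_of_irreducible_of_monic (irreducible_cubic_of_odd hr hpq) hβ hfm]
  exact Cubic.natDegree_of_a_ne_zero' one_ne_zero

/-- **`r` odd and `p + q` odd ⟹ EXACTLY ONE prime of `ℚ(β)` above `2`** (`β ∈ ℚ̄` any root of `X³ + pX² + qX + r`): the inert
criterion §2 for `K = ℚ(β)` and `b = β ∈ 𝓞 K`. KERNEL — the «splitting of `2`» datum of the unique-prime door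
(`…UniquePrimeDoor` §2) is decided from `(p, q, r) mod 2`. [folklore] -/
theorem existsUnique_two_mem_adjoin_of_odd (hr : Odd r) (hpq : Odd (p + q)) {β : AlgebraicClosure ℚ}
    (hβ : aeval β (Cubic.toPoly ⟨1, (p : ℚ), q, r⟩) = 0) :
    ∃! v : HeightOneSpectrum (𝓞 (IntermediateField.adjoin ℚ {β})),
      ((2 : ℕ) : 𝓞 (IntermediateField.adjoin ℚ {β})) ∈ v.asIdeal := by
  have hfm : (Cubic.toPoly ⟨1, (p : ℚ), q, r⟩).Monic := Cubic.monic_of_a_eq_one'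
  have hβint : IsIntegral ℚ β := ⟨_, hfm, by rwa [← aeval_def]⟩
  haveI : FiniteDimensional ℚ (IntermediateField.adjoin ℚ {β}) := IntermediateField.adjoin.finiteDimensional hβint
  haveI : NumberField (IntermediateField.adjoin ℚ {β}) := NumberField.mk
  obtain ⟨b, -, hb⟩ := exists_ringOfIntegers_cubic_root (p := p) (q := q) (r := r) hβ
  exact existsUnique_two_mem_of_cubic_root _ (finrank_adjoin_eq_three_of_odd hr hpq hβ) b hr hpq hb

/-- **`μ₂ = 0` FOR `ℚ(β)` ON THE PARITY BLOCK, modulo ONE parity bit — UNCONDITIONAL otherwise.** For `p q r : ℤ` with `r` odd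
and `p + q` odd, every root `β ∈ ℚ̄` of `X³ + pX² + qX + r`, and `2 ∤ #Cl(𝓞 ℚ(β))`: Iwasawa's classical `μ₂` vanishes (growth
form; indeed `e_n = 0` for all `n`) along EVERY `ℤ₂`-extension of `ℚ(β)` (Iwasawa 1956 through the inert criterion, both kernel).
Converse companion of `…CurveFreeHeart` §7. [cite: Greenberg2001IwasawaPastPresent, Prop. 2.1 p. 339] [cite: Washington1997, Prop. 13.22] -/
theorem classicalMuVanishes_two_adjoin_of_odd (hr : Odd r) (hpq : Odd (p + q)) {β : AlgebraicClosure ℚ}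
    (hβ : aeval β (Cubic.toPoly ⟨1, (p : ℚ), q, r⟩) = 0)
    (hh : ¬ 2 ∣ Nat.card (ClassGroup (𝓞 (IntermediateField.adjoin ℚ {β}))))
    (κ : ZpExtension (IntermediateField.adjoin ℚ {β}) 2) : ClassicalMuVanishes κ :=
  classicalMuVanishes_two_adjoin_of_unique_prime β hh (existsUnique_two_mem_adjoin_of_odd hr hpq hβ) κ

/-- The strong form: `e_n = 0` for every layer of every `ℤ₂`-extension of `ℚ(β)` (`r` odd, `p + q` odd, `2 ∤ #Cl(𝓞 ℚ(β))`).
[cite: Greenberg2001IwasawaPastPresent, Prop. 2.1 p. 339] -/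
theorem classNumberPExp_eq_zero_adjoin_of_odd (hr : Odd r) (hpq : Odd (p + q)) {β : AlgebraicClosure ℚ}
    (hβ : aeval β (Cubic.toPoly ⟨1, (p : ℚ), q, r⟩) = 0)
    (hh : ¬ 2 ∣ Nat.card (ClassGroup (𝓞 (IntermediateField.adjoin ℚ {β}))))
    (κ : ZpExtension (IntermediateField.adjoin ℚ {β}) 2) (n : ℕ) : classNumberPExp κ n = 0 := by
  have hfm : (Cubic.toPoly ⟨1, (p : ℚ), q, r⟩).Monic := Cubic.monic_of_a_eq_one'
  have hβint : IsIntegral ℚ β := ⟨_, hfm, by rwa [← aeval_def]⟩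
  haveI : FiniteDimensional ℚ (IntermediateField.adjoin ℚ {β}) := IntermediateField.adjoin.finiteDimensional hβint
  haveI : NumberField (IntermediateField.adjoin ℚ {β}) := NumberField.mk
  exact classNumberPExp_eq_zero_of_odd_classNumber_of_unique_prime _ hh (existsUnique_two_mem_adjoin_of_odd hr hpq hβ) κ n

end CubicCurrency

/-! ## §4 Per curve (mod `hLim2`): the parity block of the unique-prime door -/

section PerCurve

variable {p q r : ℤ}

/-- **(A)₂ from ONE parity bit, per curve.** Granted Lim 2017 Thm. 3.5 at `2` BY NAME (`hLim2`): for any elliptic `W/ℚ` and any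
non-zero `P ∈ W[2]` whose point field `ℚ(P) = ℚ̄^{Stab(P)}` is `ℚ(β)` for a root `β` of `X³ + pX² + qX + r` (`p q r : ℤ`, `r` odd,
`p + q` odd), `2 ∤ #Cl(𝓞 ℚ(β))` ⟹ statement (A)₂(W) (`∃ γ D` currency of C1″). CONDITIONAL on `hLim2` and the displayed bit.
[cite: Lim2017FineSelmer, §3 Thm. 3.5 and Lemma 3.2] [cite: Greenberg2001IwasawaPastPresent, Prop. 2.1 p. 339] [cite: CoatesSujatha2005, §3 statement (A)] -/
theorem fineSelmerDual_moduleFinite_two_of_odd_cubic_pointField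
    (hLim2 : Lim2017.thm35_at_two_fineSelmerDual_moduleFinite_of_classicalMuVanishes_of_le_divisionField_four)
    (W : WeierstrassCurve ℚ) [W.IsElliptic] {P : geomTorsion W 2} (hP : P ≠ 0)
    (hr : Odd r) (hpq : Odd (p + q)) {β : AlgebraicClosure ℚ} (hβ : aeval β (Cubic.toPoly ⟨1, (p : ℚ), q, r⟩) = 0)
    (hF : IntermediateField.fixedField (MulAction.stabilizer (absoluteGaloisGroup ℚ) P) = IntermediateField.adjoin ℚ {β})
    (hh : ¬ 2 ∣ Nat.card (ClassGroup (𝓞 (IntermediateField.adjoin ℚ {β}))))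
    (κ : ZpExtension ℚ 2) (hκ : κ.IsCyclotomic) :
    ∃ (γ : absoluteGaloisGroup ℚ) (D : W.FineSelmerDualData κ γ),
      Module.Finite ℤ_[2] (RestrictScalars ℤ_[2] (IwasawaAlgebra 2) D.X) := by
  have hμP : ∀ κL : ZpExtension (IntermediateField.fixedField (MulAction.stabilizer (absoluteGaloisGroup ℚ) P)) 2,
      κL.IsCyclotomic → ClassicalMuVanishes κL := by
    rw [hF]; exact fun κL _ ↦ classicalMuVanishes_two_adjoin_of_odd hr hpq hβ hh κL
  exact fineSelmerDual_moduleFinite_two_of_classicalMu_pointField hLim2 W hP hμP κ hκ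

/-- **The cubic model itself**: for `W : y² = x³ + px² + qx + r` over `ℚ` (`p q r : ℤ`, `r` odd, `p + q` odd — so the cubic is
irreducible and `W` is elliptic) and `β` a root, the `2`-torsion point `(β, 0)` has point field `ℚ(β)` (`…CubicRealization`), so
`2 ∤ #Cl(𝓞 ℚ(β))` ⟹ (A)₂(W), granted `hLim2`. [cite: Lim2017FineSelmer, §3 Thm. 3.5 and Lemma 3.2]
[cite: Greenberg2001IwasawaPastPresent, Prop. 2.1 p. 339] -/
theorem fineSelmerDual_moduleFinite_two_cubicModel_of_odd
    (hLim2 : Lim2017.thm35_at_two_fineSelmerDual_moduleFinite_of_classicalMuVanishes_of_le_divisionField_four)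
    (hr : Odd r) (hpq : Odd (p + q)) [(⟨0, (p : ℚ), 0, q, r⟩ : WeierstrassCurve ℚ).IsElliptic]
    {β : AlgebraicClosure ℚ} (hβ : aeval β (Cubic.toPoly ⟨1, (p : ℚ), q, r⟩) = 0)
    (hh : ¬ 2 ∣ Nat.card (ClassGroup (𝓞 (IntermediateField.adjoin ℚ {β}))))
    (κ : ZpExtension ℚ 2) (hκ : κ.IsCyclotomic) :
    ∃ (γ : absoluteGaloisGroup ℚ) (D : (⟨0, (p : ℚ), 0, q, r⟩ : WeierstrassCurve ℚ).FineSelmerDualData κ γ),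
      Module.Finite ℤ_[2] (RestrictScalars ℤ_[2] (IwasawaAlgebra 2) D.X) := by
  obtain ⟨P₀, hP₀, hP₀eq⟩ := exists_geomTorsion_two_eq_some_root (p : ℚ) q r hβ
  exact fineSelmerDual_moduleFinite_two_of_odd_cubic_pointField hLim2 _ hP₀ hr hpq hβ
    (fixedField_stabilizer_eq_adjoin_root (p : ℚ) q r hβ hP₀eq) hh κ hκ

end PerCurve

/-! ## §5 The smallest cubic field: `θ³ = θ + 1` (discriminant `−23`, `2` inert) -/

section Example

/-- **`μ₂ = 0` for `ℚ(θ)`, `θ³ = θ + 1`, modulo ONE bit.** For every root `θ ∈ ℚ̄` of `X³ − X − 1` (the cubic field of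
discriminant `−23`; `2` is inert by §3 — kernel) and granted only `2 ∤ #Cl(𝓞 ℚ(θ))` (in print `h = 1`, Cohen GTM 138 Table B.4;
not kernel), Iwasawa's `μ₂` vanishes (growth form) along EVERY `ℤ₂`-extension of `ℚ(θ)`. So the refutation example of
`…CurveFreeHeart` §7 is decided on the `μ₂ = 0` side (audit-2 BARRIER NOTE, rider N7). [cite: Greenberg2001IwasawaPastPresent, Prop. 2.1 p. 339]
[cite: Cohen1993, App. B Table B.4 (complex cubic fields: d = −23, h = 1)] -/
theorem classicalMuVanishes_cubicField_disc_neg23 {θ : AlgebraicClosure ℚ}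
    (hθ : aeval θ (Cubic.toPoly ⟨1, ((0 : ℤ) : ℚ), ((-1 : ℤ) : ℚ), ((-1 : ℤ) : ℚ)⟩) = 0)
    (hh : ¬ 2 ∣ Nat.card (ClassGroup (𝓞 (IntermediateField.adjoin ℚ {θ}))))
    (κ : ZpExtension (IntermediateField.adjoin ℚ {θ}) 2) : ClassicalMuVanishes κ :=
  classicalMuVanishes_two_adjoin_of_odd (p := 0) (q := -1) (r := -1) (by decide) (by decide) hθ hh κ

end Example

end Summit.BirchSwinnertonDyer.BirchSwinnertonDyer.Theorems.AddKatoTwo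

end
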